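import Summits.Langlands.Langlands.Statement
import Summits.Langlands.Langlands.Theorems.IrreducibilityBySelfDualityReciprocityUpToIrreducibilityCornerZetaIntegral
import Summits.Langlands.Langlands.Theorems.IrreducibilityBySelfDualityReciprocityUpToIrreducibilitySphericalWhittakerCorner
import Literature.NumberTheory.Automorphic.GL2RSLFactorUnramified
import Literature.NumberTheory.Automorphic.GL2RSLFactorUnramifiedComputation
import Literature.NumberTheory.Automorphic.GL2UnramifiedLFactorDivisibility
import HarnessLib

/-!
# Line `Sketch` for the crux `ReciprocityUpToIrreducibility` (item stmt-Langlands-14328), continuation c6: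
# stub S4 — the unramified `GL_n × GL₁` Rankin–Selberg computation for the spherical vector

Support file (closes nothing; continuation lead c6, stub S4 `stub_rsZeta_spherical_trivial_eq`, the
lead's own stub of wave N6').

Let `F` be a non-archimedean local field (`q = #k_F`, `ϖ` uniformising), `1 < n`, `π` a
representation of `GL_n(F)` on `V`, `ψ` of conductor `𝒪`, `Λ` a `ψ`-Whittaker functional, and
`v ∈ V^{GL_n(𝒪)}` a Hecke eigenvector with the eigenvalues of the multiset `α`
(`T_r v = q^{r(n-r)/2} e_r(α) v`, `x` an enumeration of `α`).  For the invariant measure `ν` on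
`GL₁(F) ⧸ U₁` transported from a Haar measure `μ'` of `Fˣ` and the CONSTANT Whittaker function
`W' = Λ'(v')` of the trivial representation of `GL₁(F)` on `ℂ` we prove

* `stub_rsZeta_spherical_trivial_eq`: for `‖a q^{-s}‖ < 1` (`a ∈ α`),
  `Ψ(s; W_v, W') = μ'(𝒪ˣ) Λ(v) Λ'(v') / ∏_{a ∈ α} (1 - a q^{-s})`.

Proof: the `(n, 1)` zeta integral is the corner-torus integral
`∫_{Fˣ} W_v(diag(a, 1_{n-1})) Λ'(v') |a|^{s - (n-1)/2} dμ'(a)` (stub S1,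
`stub_rsZeta_fin_one_eq_integral_corner`); the integrand vanishes for `|a| > 1` and is constant on
the shells `ϖ^m 𝒪ˣ` (stub S2, `stub_spherical_whittaker_corner`), so the shell decomposition
`integral_units_eq_tsum_shell` turns the integral into
`μ'(𝒪ˣ) ∑_m W_v(diag(ϖ^m, 1)) Λ'(v') (q^{(n-1)/2} q^{-s})^m`, which is the corner torus sum of
`RankinSelbergUnramifiedTorus` at `m = 1` (`hasSum_whittakerModel_cornerTorus`: Shintani's formula
`W_v(diag(ϖ^m, 1)) = q^{-m(n-1)/2} h_m(x) Λ(v)` and Cauchy's identity), `= Λ(v) Λ'(v') / P_{α,{1}}(q^{-s})`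
with `P_{α,{1}} = ∏ (1 - a X)` (`satakePairPolynomial_singleton_one`).  This is the rank-`n` form of
`rsZeta_spherical_glOneRep_eq` (`GL2RSLFactorUnramified`, `n = 2`, there with an unramified twist).
(Jacquet–Shalika 1981, §2; Jacquet–Piatetski-Shapiro–Shalika 1983, §2; Cogdell 2004, Thm. 3.3;
Shintani 1976.)

## References

* H. Jacquet, J. A. Shalika, *On Euler products and the classification of automorphic
  representations I*, Amer. J. Math. 103 (1981), §2. [JacquetShalika1981]
* J. W. Cogdell, *Analytic theory of L-functions for GL_n* (2004), Thm. 3.3. [CogdellAnalyticTheory2004]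
* T. Shintani, Proc. Japan Acad. 52 (1976), 180–182. [Shintani1976]
-/

open scoped MatrixGroups Matrix NumberField Classical Polynomial NNReal
open Filter IsDedekindDomain Field Polynomial MeasureTheory Finset Literature.NumberTheory.Automorphic
  Literature.NumberTheory.GaloisRepresentations Literature.NumberTheory.PAdicHodge Summit.Langlands
  Literature.NumberTheory.GaloisRepresentations.IsNonarchimedeanLocalField
  Literature.NumberTheory.EllipticCurves.Hida2000Thm326

noncomputable section
set_option linter.dupNamespace false -- project-wide option (lakefile weak.linter.dupNamespace); `Summit.Langlands.Langlands` is the mandated namespace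

namespace Summit.Langlands.Langlands.Theorems.ReciprocityUpToIrreducibility

/-- `(q⁻¹)^{s - (n-1)/2} = (√q)^{n-1} · q^{-s}` for `1 ≤ n` (the `δ^{1/2}`-shift of the `GL_n × GL₁`
integrand; rank-`n` form of `inv_residueFieldCard_cpow_sub_one_half`). [folklore] -/
theorem inv_residueFieldCard_cpow_sub_pred_half {F : Type*} [Field F] [ValuativeRel F]
    [TopologicalSpace F] [IsNonarchimedeanLocalField F] {n : ℕ} (hn : 1 ≤ n) (s : ℂ) :
    ((((residueFieldCard F : ℝ≥0)⁻¹ : ℝ≥0) : ℝ) : ℂ) ^ (s - ((n : ℂ) - 1) / 2) =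
      ((Real.sqrt (residueFieldCard F) : ℝ) : ℂ) ^ (n - 1) * (residueFieldCard F : ℂ) ^ (-s) := by
  have hq0 : (0 : ℝ) ≤ (residueFieldCard F : ℝ) := Nat.cast_nonneg _
  have hr0 : (0 : ℝ) < (((residueFieldCard F : ℝ≥0)⁻¹ : ℝ≥0) : ℝ) := by
    exact_mod_cast inv_residueFieldCard_pos (F := F)
  have hxq : ((((residueFieldCard F : ℝ≥0)⁻¹ : ℝ≥0) : ℝ) : ℂ) = ((residueFieldCard F : ℂ))⁻¹ := by
    rw [NNReal.coe_inv, NNReal.coe_natCast, Complex.ofReal_inv, Complex.ofReal_natCast]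
  have hxne : ((((residueFieldCard F : ℝ≥0)⁻¹ : ℝ≥0) : ℝ) : ℂ) ≠ 0 := Complex.ofReal_ne_zero.2 hr0.ne'
  have harg : ((residueFieldCard F : ℕ) : ℂ).arg ≠ Real.pi := by
    rw [Complex.natCast_arg]; exact Real.pi_ne_zero.symm
  have hcast : ((n : ℂ) - 1) / 2 = ((n - 1 : ℕ) : ℂ) * (1 / 2 : ℂ) := by
    rw [Nat.cast_sub hn, Nat.cast_one]; ring
  rw [show s - ((n : ℂ) - 1) / 2 = -(((n : ℂ) - 1) / 2) + s by ring, Complex.cpow_add _ _ hxne, hxq,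
    Complex.inv_cpow _ _ harg, Complex.inv_cpow _ _ harg, Complex.cpow_neg, Complex.cpow_neg, inv_inv,
    hcast, Complex.cpow_nat_mul]
  congr 2
  rw [Real.sqrt_eq_rpow, Complex.ofReal_cpow hq0, Complex.ofReal_natCast]
  congr 1
  push_cast
  ring

/-- **stub S4 (the unramified computation for `GL_n × GL₁`, spherical vector against the trivial
character; lead).**  Let `ψ` have conductor `𝒪`, `Λ` be a `ψ`-Whittaker functional, `v ∈ V^{GL_n(𝒪)}`
a Hecke eigenvector with the eigenvalues of `α` (`T_r v = q^{r(n-r)/2} e_r(α) v`, `x` enumerating `α`),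
`ν` transported from a Haar measure `μ'` of `Fˣ`, and `W' = Λ'(v')` the constant Whittaker function of
the trivial representation of `GL₁(F)` on `ℂ`.  Then for `‖a q^{-s}‖ < 1` (`a ∈ α`):
`Ψ(s; W_v, W') = μ'(𝒪ˣ) Λ(v) Λ'(v') / ∏_{a ∈ α} (1 - a q^{-s})` — S1 + S2 + the shells
`integral_units_eq_tsum_shell` + the corner torus sum `hasSum_whittakerModel_cornerTorus` at `m = 1`
(Shintani: `W_v(diag(ϖ^N, 1)) = q^{-N(n-1)/2} h_N(x) Λ(v)`).  Rank-`n` form of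
`rsZeta_spherical_glOneRep_eq` (`GL2RSLFactorUnramified`, there with a twist `χ`).
[cite: JacquetShalika1981, §2] [cite: CogdellAnalyticTheory2004, Thm. 3.3] [cite: Shintani1976, Theorem] -/
theorem stub_rsZeta_spherical_trivial_eq :
    ∀ (F : Type) [Field F] [ValuativeRel F] [TopologicalSpace F] [IsNonarchimedeanLocalField F]
      [MeasurableSpace F] [BorelSpace F] (n : ℕ) (hn : 1 < n) (V : Type) [AddCommGroup V] [Module ℂ V]
      (π : Representation ℂ (GL (Fin n) F) V) (ϖ : F) (hϖ : IsUniformizingElement ϖ)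
      (ψ : AddChar F Circle), ψ.HasConductorExp 0 →
      ∀ (Λ : Module.Dual ℂ V), Λ ∈ whittakerFunctionals π ψ →
      ∀ (v : V), v ∈ π.fixedPoints (glInt n F) →
      ∀ (α : Multiset ℂ) (x : Fin n → ℂ), (Finset.univ : Finset (Fin n)).val.map x = α →
      (∀ r, 1 ≤ r → r ≤ n → heckeT π (Units.mk0 ϖ hϖ.ne_zero) r v =
        ((((Real.sqrt (IsNonarchimedeanLocalField.residueFieldCard F)) ^ (r * (n - r)) : ℝ) : ℂ) * α.esymm r) • v) →
      ∀ [MeasurableSpace (GL (Fin 1) F ⧸ upperUnitriangular (Fin 1) F)]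
        (μ' : MeasureTheory.Measure Fˣ) [μ'.IsHaarMeasure]
        (ν : MeasureTheory.Measure (GL (Fin 1) F ⧸ upperUnitriangular (Fin 1) F)),
      (∀ f : GL (Fin 1) F ⧸ upperUnitriangular (Fin 1) F → ℂ,
        ∫ x, f x ∂ν = ∫ a : Fˣ, f (QuotientGroup.mk (glDiagonal 1 F fun _ => a)) ∂μ') →
      ∀ (Λ' : Module.Dual ℂ ℂ) (v' : ℂ) (s : ℂ),
      (∀ a ∈ α, ‖a * (IsNonarchimedeanLocalField.residueFieldCard F : ℂ) ^ (-s)‖ < 1) →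
        rsZeta hn ν (whittakerModel π Λ v)
          (whittakerModel (Representation.trivial ℂ (GL (Fin 1) F) ℂ) Λ' v') s =
          (μ' {x : Fˣ | ValuativeRel.valuation F (x : F) = 1}).toReal *
            (Λ v * Λ' v' * (((α.map fun a => (1 : ℂ[X]) - C a * X).prod).eval
              ((IsNonarchimedeanLocalField.residueFieldCard F : ℂ) ^ (-s)))⁻¹) := by
  -- adapted from `Literature.NumberTheory.Automorphic.rsZeta_spherical_glOneRep_eq` (`n = 2`)
  intro F _ _ _ _ _ _ n hn V _ _ π ϖ hϖ ψ hψ0 Λ hΛ v hv α x hx hT _ μ' _ ν hint Λ' v' s hs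
  classical
  haveI : T2Space F :=
    (Literature.NumberTheory.GaloisRepresentations.IsNonarchimedeanLocalField.isLocalField F).toT2Space
  haveI : BorelSpace Fˣ := Units.borelSpace
  have hϖ0 : ϖ ≠ 0 := hϖ.ne_zero
  set ϖu : Fˣ := Units.mk0 ϖ hϖ0 with hϖu_def
  have hϖn : normAbs F (ϖu : F) = (residueFieldCard F : ℝ≥0)⁻¹ := by
    rw [hϖu_def, Units.val_mk0]; exact normAbs_eq_inv_of_isUniformizingElement hϖ
  set q : ℕ := residueFieldCard F with hq_def
  set t : ℂ := (q : ℂ) ^ (-s) with ht_def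
  set sq : ℂ := ((Real.sqrt (residueFieldCard F) : ℝ) : ℂ) with hsq_def
  -- the trivial representation of `GL₁(F)` on `ℂ`: every vector is spherical with Satake parameter `{1}`
  set ρ' : Representation ℂ (GL (Fin 1) F) ℂ := Representation.trivial ℂ (GL (Fin 1) F) ℂ with hρ'_def
  have hW' : ∀ g, whittakerModel ρ' Λ' v' g = Λ' v' := fun g => whittakerModel_trivial_apply Λ' v' g
  have hΛ' : Λ' ∈ whittakerFunctionals ρ' ψ := by
    rw [whittakerFunctionals_eq_top_of_fin_one]; exact Submodule.mem_top
  have hv'fix : v' ∈ ρ'.fixedPoints (glInt 1 F) := by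
    rw [Representation.mem_fixedPoints]
    intro k _
    rw [hρ'_def, Representation.trivial_apply]
  have hy : (univ : Finset (Fin 1)).val.map (fun _ : Fin 1 => (1 : ℂ)) = ({1} : Multiset ℂ) := rfl
  have hT' : ∀ r, 1 ≤ r → r ≤ 1 → heckeT ρ' (Units.mk0 ϖ hϖ.ne_zero) r v' =
      ((((Real.sqrt (residueFieldCard F)) ^ (r * (1 - r)) : ℝ) : ℂ) * ({1} : Multiset ℂ).esymm r) • v' := by
    intro r hr1 hr2
    obtain rfl : r = 1 := le_antisymm hr2 hr1
    rw [heckeT_self_apply _ _ hv'fix, hρ'_def, Representation.trivial_apply, Nat.sub_self, mul_zero,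
      pow_zero, Complex.ofReal_one, one_mul, Multiset.esymm, Multiset.powersetCard_one,
      Multiset.map_singleton, Multiset.map_singleton, Multiset.prod_singleton, Multiset.sum_singleton,
      one_smul]
  have hs' : ∀ a ∈ α, ∀ b ∈ ({1} : Multiset ℂ), ‖a * b * t‖ < 1 := by
    intro a ha b hb
    rw [Multiset.mem_singleton.1 hb, mul_one]
    exact hs a ha
  -- Part 1: the zeta integral is the corner-torus integral (stub S1)
  rw [stub_rsZeta_fin_one_eq_integral_corner F n hn μ' ν hint (whittakerModel π Λ v)
    (whittakerModel ρ' Λ' v') (Λ' v') hW' s]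
  -- Part 2: the corner torus sum (Shintani + Cauchy) at `m = 1`
  have hS := hasSum_whittakerModel_cornerTorus hn.le π ρ' hϖ hψ0 hψ0 hΛ hΛ' hv hv'fix hx hy hT hT' hs'
  have hpi : ∀ N : ℕ, piPowGL hϖ.ne_zero (fun _ : Fin 1 => N) = glDiagonal 1 F (fun _ => ϖu ^ N) :=
    fun N => by rw [← glDiagonal_det_eq (piPowGL hϖ.ne_zero _), det_piPowGL_fin_one]
  set w : ℕ → ℂ := fun m =>
    whittakerModel π Λ v (glCorner F hn.le (glDiagonal 1 F fun _ => ϖu ^ m)) * Λ' v' *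
      (sq ^ (n - 1) * t) ^ m with hw_def
  have hS' : HasSum w (Λ v * Λ' v' * ((satakePairPolynomial α {1}).eval t)⁻¹) := by
    convert hS using 1
    funext N
    simp only [hw_def, piAntidiag_univ_fin_one, Finset.sum_singleton, torusExponent_fin_one, zpow_zero,
      one_mul, hW', hpi, ← hsq_def, mul_pow, ← pow_mul]
    ring
  have hsum : Summable fun m => ‖w m‖ := summable_norm_iff.2 hS'.summable
  -- Part 3: the shell description of the integrand (stub S2)
  obtain ⟨h0, h1⟩ := stub_spherical_whittaker_corner F n hn V π ψ hψ0 Λ hΛ v hv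
  have hr0 : (0 : ℝ) < (((residueFieldCard F : ℝ≥0)⁻¹ : ℝ≥0) : ℝ) := by
    exact_mod_cast inv_residueFieldCard_pos (F := F)
  set f : Fˣ → ℂ := fun a => whittakerModel π Λ v (glCorner F hn.le (glDiagonal 1 F fun _ => a)) *
    Λ' v' * (((normAbs F (a : F) : ℝ≥0) : ℝ) : ℂ) ^ (s - ((n : ℂ) - 1) / 2) with hf_def
  have hf0 : ∀ a : Fˣ, 1 < normAbs F (a : F) → f a = 0 := fun a ha => by
    simp only [hf_def]
    rw [h0 a ha, zero_mul, zero_mul]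
  have hfv : ∀ (m : ℕ) (a : Fˣ), normAbs F (a : F) = ((residueFieldCard F : ℝ≥0)⁻¹) ^ (m : ℤ) →
      f a = w m := by
    intro m a ha
    set u : Fˣ := (ϖu ^ m)⁻¹ * a with hu_def
    have hau : a = ϖu ^ m * u := by rw [hu_def, mul_inv_cancel_left]
    have hu : ValuativeRel.valuation F (u : F) = 1 := by
      rw [← normAbs_eq_one_iff_valuation_eq_one, hu_def, Units.val_mul, Units.val_inv_eq_inv_val,
        Units.val_pow_eq_pow_val, map_mul, map_inv₀, map_pow, hϖn, ha, zpow_natCast, inv_mul_cancel₀]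
      exact pow_ne_zero _ inv_residueFieldCard_pos.ne'
    have hWa : whittakerModel π Λ v (glCorner F hn.le (glDiagonal 1 F fun _ => a)) =
        whittakerModel π Λ v (glCorner F hn.le (glDiagonal 1 F fun _ => ϖu ^ m)) := by
      rw [hau, h1 _ _ hu]
    have habs : (((normAbs F (a : F) : ℝ≥0) : ℝ) : ℂ) ^ (s - ((n : ℂ) - 1) / 2) = (sq ^ (n - 1) * t) ^ m := by
      rw [ha, NNReal.coe_zpow, ofReal_zpow_cpow hr0, inv_residueFieldCard_cpow_sub_pred_half hn.le,
        zpow_natCast]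
    simp only [hf_def, hw_def]
    rw [hWa, habs]
  -- Part 4: shells
  rw [integral_units_eq_tsum_shell μ' hf0 hfv hsum, hS'.tsum_eq, satakePairPolynomial_singleton_one]

end Summit.Langlands.Langlands.Theorems.ReciprocityUpToIrreducibility

end
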